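import Literature.Barriers.Schanuel.AlgebraicIndependenceOfLogarithmsThm4FromThm2A
import HarnessLib

/-!
# Barrier (Schanuel): Roy 1992, §2 — the objects and morphisms of Roy's category `𝒞`

Support file (everything proved; no named facts) for the deduction
`roy1992_thm1 → roy1992_thm2` (Roy's Theorem 2 from M. Waldschmidt's Theorem 1, [Roy1992] §§2–3;
the two theorems are the named facts of
`Literature.Barriers.Schanuel.AlgebraicIndependenceOfLogarithmsRoyThm12`). Roy proves Theorem 2
by rephrasing both theorems in a category `𝒞` (§2) and applying his abstract Theorem 3 (§3,
proved in `Literature.Barriers.Schanuel.AlgebraicIndependenceOfLogarithmsRoyThm3`; the abstract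
form of Theorem 2bis is `Roy1992.AdmissibleCat.thm2bis` in
`Literature.Barriers.Schanuel.AlgebraicIndependenceOfLogarithmsRoyThm2bis`). This file sets up the
concrete side of §2: the objects of `𝒞`, its morphisms, kernels and cokernels, the image object
`X' = (K^{d₀'} × K^{d₁'}, s(Y), s(W), s(V))` of a cokernel, the functions `a, b, c, d, r, d₀, d₁`,
and the dictionary between the language of Theorem 2bis and that of Theorem 2 (the ratio
`d₁(X')/b(X')`, and "no kernel `i : X* → X'` with `d₁(X*) = b(X*) = 0`, `r(X*) ≠ 0`" versus
"`s(V) ∩ (ℚ̄^{d₀'} × 0) = 0`"). Propositions 1–3 (admissibility, additivity, the special cokernel)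
and the assembly are left to the next companions.

## What the source prints [Roy1992, §2, pp. 26–27]

* "The category `𝒞` is defined as follows. Its objects are the families `(K^{d₀} × K^{d₁}, Y, W, V)`
  where `d₀, d₁, Y, W, V` are as in Theorem 1. Its morphisms from an object
  `X₁ = (K^{d₀₁} × K^{d₁₁}, Y₁, W₁, V₁)` to an object `X₂ = (K^{d₀₂} × K^{d₁₂}, Y₂, W₂, V₂)` are the
  triples `(X₁, X₂, f)`, where `f` is a `K`-linear mapping from `K^{d₀₁} × K^{d₁₁}` to
  `K^{d₀₂} × K^{d₁₂}` such that `f(ℚ̄^{d₀₁} × 0) ⊂ ℚ̄^{d₀₂} × 0`, `f(0 × ℚ^{d₁₁}) ⊂ 0 × ℚ^{d₁₂}`,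
  `f(Y₁) ⊂ Y₂`, `f(W₁) ⊂ W₂`, `f(V₁) ⊂ V₂`."
* "We say that a morphism `(X*, X, i)` from `X*` to `X` is a kernel of `𝒞` if the linear mapping
  `i` is injective and satisfies `Y* = i⁻¹(Y)`, `W* = i⁻¹(W)`, `V* = i⁻¹(V)`. We say that a
  morphism `(X, X', s)` from `X` to `X'` is a cokernel of `𝒞` if the linear mapping `s` is
  surjective and satisfies `Y' = s(Y)`, `W' = s(W)`, `V' = s(V)`."
* "`a(X) = d₁ − dim_ℚ(Y ∩ Ω)` where `Ω = 0 × ωℚ^{d₁}`, `b(X) = d₀ + d₁ − dim_K(V)`,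
  `c(X) = dim_ℚ(Y)`, `d(X) = dim_K(V/W)`, `r(X) = d₀ + d₁`, `d₀(X) = d₀`, `d₁(X) = d₁`."
* (§2 Theorem 2bis and §1 Theorem 2) the condition "there does not exist in `𝒞` any kernel
  `i : X* → X'` with codomain `X'` such that `d₁(X*) = b(X*) = 0` and `r(X*) ≠ 0`" of Theorem 2bis
  is the condition "`s(V) ∩ (ℚ̄^{d₀'} × 0) = 0`" of Theorem 2, and the ratio `d₁(X')/b(X')` is
  `d₁'/(d₀' + d₁' − dim_K(s(V)))`.

## Lean rendering

`Roy1992.Obj` bundles `(d₀, d₁, Y, W, V)` with the hypotheses of Theorem 1 (the fields of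
`roy1992_thm1`/`roy1992_thm2`: `FiniteDimensional ℚ Y`, `IsQbarLogSubspace Y`, `IsQbarRational W`,
`Y ≤ V`, `W ≤ V`). `Roy1992.IsBiRational f` is the pair of rationality conditions on morphisms
(`IsAdmissible f ↔ Surjective f ∧ IsBiRational f` definitionally); such an `f` is a product
`f₀ × f₁` of a map given by a matrix over `ℚ̄` and one given by a matrix over `ℚ`
(`exists_eq_prodMap_of_isBiRational`), hence maps `ℚ̄`-points to `ℚ̄`-points, `ℚ`-subspaces of
`ℚ̄^{d₀} × L^{d₁}` to such subspaces, and subspaces rational over `ℚ̄` to such subspaces; this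
gives the image object `Obj.mapObj`. `Obj.IsCokerMap X X' s` / `Obj.IsKerMap A X i` are the printed
kernel/cokernel conditions (the inclusions `f(Y₁) ⊂ Y₂, …` being implied by the equalities).
`Roy1992.fa, fb, fc, fd, fr, fd₀, fd₁ : Obj → ℕ` are the functions of §2 (natural subtraction is
harmless: `dim_ℚ(Y ∩ Ω) ≤ d₁`, `dim W ≤ dim V ≤ d₀ + d₁`, see the `cast_*` lemmas).
`Obj.thm2Ratio_eq` identifies the ratio, and `Obj.noBadKernel_iff` proves the equivalence of the
two kernel conditions (a bad kernel sends `(e₁, 0)` to a non-zero point of `s(V) ∩ (ℚ̄^{d₀'} × 0)`;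
conversely such a point `v` gives the bad kernel `K¹ × K⁰ → K^{d₀'} × K^{d₁'}`, `t ↦ t v`).

## References

* [Roy1992] D. Roy, *Matrices whose coefficients are linear forms in logarithms*, J. Number
  Theory 41 (1992) 22–47: §1 Theorems 1–2 (p. 25); §2 (pp. 26–27).
-/

noncomputable section

open Module Submodule Complex

namespace Literature.Barriers.Schanuel.Roy1992

/-! ### Objects -/

/-- **The objects of Roy's category `𝒞`**: "the families `(K^{d₀} × K^{d₁}, Y, W, V)` where
`d₀, d₁, Y, W, V` are as in Theorem 1" — `Y` a finite-dimensional `ℚ`-subspace of `K^{d₀} × K^{d₁}`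
contained in `ℚ̄^{d₀} × L^{d₁}`, `W` a `K`-subspace rational over `ℚ̄`, `V` a `K`-subspace containing
`Y` and `W`. [cite: Roy1992, §2 (p. 26)] -/
structure Obj where
  /-- `d₀` -/
  d₀ : ℕ
  /-- `d₁` -/
  d₁ : ℕ
  /-- `Y ⊆ ℚ̄^{d₀} × L^{d₁}`, a finite-dimensional `ℚ`-subspace -/
  Y : Submodule ℚ (LinTangent d₀ d₁)
  /-- `W`, a `K`-subspace rational over `ℚ̄` -/
  W : Submodule ℂ (LinTangent d₀ d₁)
  /-- `V ⊇ Y, W` -/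
  V : Submodule ℂ (LinTangent d₀ d₁)
  finite : FiniteDimensional ℚ Y
  isLog : IsQbarLogSubspace Y
  isRat : IsQbarRational W
  hYV : Y ≤ V.restrictScalars ℚ
  hWV : W ≤ V

/-- `Y` is finite dimensional over `ℚ`. [cite: Roy1992, §1 Theorem 1 (p. 25)] -/
instance Obj.instFiniteDimensionalY (X : Obj) : FiniteDimensional ℚ X.Y := X.finite

variable {d₀ d₁ d₀' d₁' d₀'' d₁'' : ℕ}

/-! ### Morphisms: the two rationality conditions -/

/-- The rationality conditions on the underlying linear map of a morphism of `𝒞`: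
`f(ℚ̄^{d₀} × 0) ⊆ ℚ̄^{d₀'} × 0` and `f(0 × ℚ^{d₁}) ⊆ 0 × ℚ^{d₁'}` (so that `IsAdmissible f` is
`Surjective f ∧ IsBiRational f`). [cite: Roy1992, §2 (p. 26)] -/
def IsBiRational (f : LinTangent d₀ d₁ →ₗ[ℂ] LinTangent d₀' d₁') : Prop :=
  (∀ x : Fin d₀ → ℂ, (∀ i, x i ∈ algebraicClosure ℚ ℂ) →
      (∀ i, (f (x, 0)).1 i ∈ algebraicClosure ℚ ℂ) ∧ (f (x, 0)).2 = 0) ∧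
    (∀ y : Fin d₁ → ℂ, (∀ j, y j ∈ Set.range ((↑) : ℚ → ℂ)) →
      (f (0, y)).1 = 0 ∧ ∀ j, (f (0, y)).2 j ∈ Set.range ((↑) : ℚ → ℂ))

/-- `IsAdmissible f ↔ Surjective f ∧ IsBiRational f` (by definition). [cite: Roy1992, §1 Theorem 1 (p. 25)] -/
theorem isAdmissible_iff (f : LinTangent d₀ d₁ →ₗ[ℂ] LinTangent d₀' d₁') :
    IsAdmissible f ↔ Function.Surjective f ∧ IsBiRational f := Iff.rfl

/-- The identity is a morphism. [folklore] -/
theorem IsBiRational.id (d₀ d₁ : ℕ) :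
    IsBiRational (LinearMap.id : LinTangent d₀ d₁ →ₗ[ℂ] LinTangent d₀ d₁) :=
  (isAdmissible_id d₀ d₁).2

/-- Morphisms compose. [cite: Roy1992, §2 (p. 26)] -/
theorem IsBiRational.comp {g : LinTangent d₀' d₁' →ₗ[ℂ] LinTangent d₀'' d₁''}
    {f : LinTangent d₀ d₁ →ₗ[ℂ] LinTangent d₀' d₁'} (hg : IsBiRational g) (hf : IsBiRational f) :
    IsBiRational (g ∘ₗ f) := by
  refine ⟨fun x hx => ?_, fun y hy => ?_⟩
  · obtain ⟨h1, h2⟩ := hf.1 x hx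
    have hfx : f (x, 0) = ((f (x, 0)).1, 0) := by ext1 <;> simp [h2]
    rw [LinearMap.comp_apply, hfx]
    exact hg.1 _ h1
  · obtain ⟨h1, h2⟩ := hf.2 y hy
    have hfy : f (0, y) = (0, (f (0, y)).2) := by ext1 <;> simp [h1]
    rw [LinearMap.comp_apply, hfy]
    exact hg.2 _ h2

/-- Admissible maps compose. [folklore] -/
theorem isAdmissible_comp {g : LinTangent d₀' d₁' →ₗ[ℂ] LinTangent d₀'' d₁''}
    {f : LinTangent d₀ d₁ →ₗ[ℂ] LinTangent d₀' d₁'} (hg : IsAdmissible g) (hf : IsAdmissible f) :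
    IsAdmissible (g ∘ₗ f) :=
  ⟨hg.1.comp hf.1, IsBiRational.comp hg.2 hf.2⟩

/-- **Morphisms are products `f₀ × f₁`** of a map given by a matrix over `ℚ̄` and a map given by a
matrix over `ℚ` (the off-diagonal blocks of `f` vanish on the standard bases, the diagonal blocks
have algebraic, resp. rational, matrices). [cite: Roy1992, §2 proof of Proposition 2 (p. 28) and §4 (p. 35)] -/
theorem exists_eq_prodMap_of_isBiRational {f : LinTangent d₀ d₁ →ₗ[ℂ] LinTangent d₀' d₁'}
    (hf : IsBiRational f) :
    ∃ (A₀ : Matrix (Fin d₀') (Fin d₀) (algebraicClosure ℚ ℂ)) (A₁ : Matrix (Fin d₁') (Fin d₁) ℚ),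
      f = (A₀.map (algebraMap (algebraicClosure ℚ ℂ) ℂ)).mulVecLin.prodMap
            (A₁.map (algebraMap ℚ ℂ)).mulVecLin := by
  obtain ⟨h0, h1⟩ := hf
  set f₀ : (Fin d₀ → ℂ) →ₗ[ℂ] (Fin d₀' → ℂ) :=
    LinearMap.fst ℂ _ _ ∘ₗ f ∘ₗ LinearMap.inl ℂ _ _ with hf₀
  set f₁ : (Fin d₁ → ℂ) →ₗ[ℂ] (Fin d₁' → ℂ) :=
    LinearMap.snd ℂ _ _ ∘ₗ f ∘ₗ LinearMap.inr ℂ _ _ with hf₁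
  have hsingle0 : ∀ i : Fin d₀, ∀ k, (Pi.single i (1 : ℂ) : Fin d₀ → ℂ) k ∈ algebraicClosure ℚ ℂ := by
    intro i k
    by_cases h : k = i
    · subst h; simp
    · simp [h]
  have hsingle1 : ∀ j : Fin d₁, ∀ k,
      (Pi.single j (1 : ℂ) : Fin d₁ → ℂ) k ∈ Set.range ((↑) : ℚ → ℂ) := by
    intro j k
    by_cases h : k = j
    · subst h; exact ⟨1, by simp⟩
    · exact ⟨0, by simp [h]⟩
  have hoff0 : (LinearMap.snd ℂ _ _ ∘ₗ f ∘ₗ LinearMap.inl ℂ _ (Fin d₁ → ℂ)) = 0 :=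
    eq_zero_of_forall_single _ fun i => (h0 _ (hsingle0 i)).2
  have hoff1 : (LinearMap.fst ℂ _ _ ∘ₗ f ∘ₗ LinearMap.inr ℂ (Fin d₀ → ℂ) _) = 0 :=
    eq_zero_of_forall_single _ fun j => (h1 _ (hsingle1 j)).1
  have hdec : ∀ x y, f (x, y) = (f₀ x, f₁ y) := by
    intro x y
    have hx : f (x, 0) = (f₀ x, 0) := by
      ext1
      · rfl
      · exact congrArg (fun g => g x) (congrArg DFunLike.coe hoff0)
    have hy : f (0, y) = (0, f₁ y) := by
      ext1
      · exact congrArg (fun g => g y) (congrArg DFunLike.coe hoff1)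
      · rfl
    calc f (x, y) = f ((x, 0) + (0, y)) := by simp
      _ = (f₀ x, f₁ y) := by rw [map_add, hx, hy]; simp
  have hA₀mem : ∀ i j, LinearMap.toMatrix' f₀ i j ∈ algebraicClosure ℚ ℂ := by
    intro i j
    rw [LinearMap.toMatrix'_apply]
    exact (h0 _ (hsingle0 j)).1 i
  have hA₁mem : ∀ i j, LinearMap.toMatrix' f₁ i j ∈ Set.range ((↑) : ℚ → ℂ) := by
    intro i j
    rw [LinearMap.toMatrix'_apply]
    exact (h1 _ (hsingle1 j)).2 i
  let A₀ : Matrix (Fin d₀') (Fin d₀) (algebraicClosure ℚ ℂ) := fun i j => ⟨_, hA₀mem i j⟩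
  let A₁ : Matrix (Fin d₁') (Fin d₁) ℚ := fun i j => Classical.choose (hA₁mem i j)
  have hA₀ : A₀.map (algebraMap (algebraicClosure ℚ ℂ) ℂ) = LinearMap.toMatrix' f₀ := by
    ext i j; rfl
  have hA₁ : A₁.map (algebraMap ℚ ℂ) = LinearMap.toMatrix' f₁ := by
    ext i j
    exact Classical.choose_spec (hA₁mem i j)
  have hm₀ : (A₀.map (algebraMap (algebraicClosure ℚ ℂ) ℂ)).mulVecLin = f₀ := by
    rw [hA₀, ← Matrix.toLin'_apply', Matrix.toLin'_toMatrix']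
  have hm₁ : (A₁.map (algebraMap ℚ ℂ)).mulVecLin = f₁ := by
    rw [hA₁, ← Matrix.toLin'_apply', Matrix.toLin'_toMatrix']
  refine ⟨A₀, A₁, ?_⟩
  rw [hm₀, hm₁]
  refine LinearMap.ext fun p => ?_
  obtain ⟨x, y⟩ := p
  rw [hdec, LinearMap.prodMap_apply]

/-- A product `f₀ × f₁` of a map given by a matrix over `ℚ̄` and a map given by a matrix over `ℚ`
is a morphism. [cite: Roy1992, §2 (p. 26)] -/
theorem isBiRational_prodMap (A₀ : Matrix (Fin d₀') (Fin d₀) (algebraicClosure ℚ ℂ))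
    (A₁ : Matrix (Fin d₁') (Fin d₁) ℚ) :
    IsBiRational ((A₀.map (algebraMap (algebraicClosure ℚ ℂ) ℂ)).mulVecLin.prodMap
      (A₁.map (algebraMap ℚ ℂ)).mulVecLin) := by
  refine ⟨fun x hx => ⟨fun i => ?_, ?_⟩, fun y hy => ⟨?_, fun j => ?_⟩⟩
  · simp only [LinearMap.prodMap_apply, Matrix.mulVecLin_apply, Matrix.mulVec, dotProduct,
      Matrix.map_apply]
    exact sum_mem fun j _ => mul_mem (SetLike.coe_mem _) (hx j)
  · simp
  · simp
  · simp only [LinearMap.prodMap_apply, Matrix.mulVecLin_apply, Matrix.mulVec, dotProduct,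
      Matrix.map_apply]
    choose q hq using hy
    refine ⟨∑ k, A₁ j k * q k, ?_⟩
    push_cast
    exact Finset.sum_congr rfl fun k _ => by rw [hq k]; rfl

/-- Morphisms map `ℚ̄`-points to `ℚ̄`-points. [cite: Roy1992, §2 (p. 26)] -/
theorem IsBiRational.isQbarPoint {f : LinTangent d₀ d₁ →ₗ[ℂ] LinTangent d₀' d₁'}
    (hf : IsBiRational f) {v : LinTangent d₀ d₁} (hv : IsQbarPoint v) : IsQbarPoint (f v) := by
  obtain ⟨A₀, A₁, rfl⟩ := exists_eq_prodMap_of_isBiRational hf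
  obtain ⟨x, y⟩ := v
  refine ⟨fun i => ?_, fun j => ?_⟩
  · simp only [LinearMap.prodMap_apply, Matrix.mulVecLin_apply, Matrix.mulVec, dotProduct,
      Matrix.map_apply]
    exact sum_mem fun k _ => mul_mem (SetLike.coe_mem _) (hv.1 k)
  · simp only [LinearMap.prodMap_apply, Matrix.mulVecLin_apply, Matrix.mulVec, dotProduct,
      Matrix.map_apply]
    refine sum_mem fun k _ => mul_mem ?_ (hv.2 k)
    rw [mem_algebraicClosure_iff]
    exact isAlgebraic_algebraMap _

/-- Morphisms map `ℚ`-subspaces of `ℚ̄^{d₀} × L^{d₁}` to `ℚ`-subspaces of `ℚ̄^{d₀'} × L^{d₁'}` (the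
second block is a matrix over `ℚ`, and `L` is a `ℚ`-subspace: `isAlgebraic_cexp_of_mem_logQSpan`).
[cite: Roy1992, §2 (p. 26)] -/
theorem IsBiRational.isQbarLogSubspace_map {f : LinTangent d₀ d₁ →ₗ[ℂ] LinTangent d₀' d₁'}
    (hf : IsBiRational f) {Y : Submodule ℚ (LinTangent d₀ d₁)} (hY : IsQbarLogSubspace Y) :
    IsQbarLogSubspace (Y.map (f.restrictScalars ℚ)) := by
  obtain ⟨A₀, A₁, rfl⟩ := exists_eq_prodMap_of_isBiRational hf
  rintro _ ⟨⟨x, y⟩, hyY, rfl⟩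
  obtain ⟨hx, hy⟩ := hY _ hyY
  refine ⟨fun i => ?_, fun j => ?_⟩
  · simp only [LinearMap.restrictScalars_apply, LinearMap.prodMap_apply, Matrix.mulVecLin_apply,
      Matrix.mulVec, dotProduct, Matrix.map_apply]
    exact sum_mem fun k _ => mul_mem (SetLike.coe_mem _) (hx k)
  · simp only [LinearMap.restrictScalars_apply, LinearMap.prodMap_apply, Matrix.mulVecLin_apply,
      Matrix.mulVec, dotProduct, Matrix.map_apply]
    refine isAlgebraic_cexp_of_mem_logQSpan (sum_mem fun k _ => ?_)
    rw [Algebra.algebraMap_eq_smul_one, smul_mul_assoc, one_mul]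
    exact Submodule.smul_mem _ _ (Submodule.subset_span (hy k))

/-- Morphisms map subspaces rational over `ℚ̄` to subspaces rational over `ℚ̄`.
[cite: Roy1992, §2 (p. 26)] -/
theorem IsBiRational.isQbarRational_map {f : LinTangent d₀ d₁ →ₗ[ℂ] LinTangent d₀' d₁'}
    (hf : IsBiRational f) {W : Submodule ℂ (LinTangent d₀ d₁)} (hW : IsQbarRational W) :
    IsQbarRational (W.map f) := by
  unfold IsQbarRational at hW ⊢
  refine le_antisymm ?_ (Submodule.span_le.2 fun v hv => hv.1)
  have h1 : W.map f = Submodule.span ℂ (f '' {v | v ∈ W ∧ IsQbarPoint v}) := by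
    conv_lhs => rw [hW]
    rw [LinearMap.map_span]
  refine h1.le.trans (Submodule.span_mono ?_)
  rintro _ ⟨v, ⟨hvW, hvq⟩, rfl⟩
  exact ⟨Submodule.mem_map_of_mem hvW, hf.isQbarPoint hvq⟩

namespace Obj

/-- **The image object** `X' = (K^{d₀'} × K^{d₁'}, s(Y), s(W), s(V))` of an admissible (or merely
bi-rational) map `s`: "Then `X'` is an object of `𝒞`". [cite: Roy1992, §2 proof of Proposition 3 (p. 29)] -/
def mapObj (X : Obj) (s : LinTangent X.d₀ X.d₁ →ₗ[ℂ] LinTangent d₀' d₁') (hs : IsBiRational s) :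
    Obj where
  d₀ := d₀'
  d₁ := d₁'
  Y := X.Y.map (s.restrictScalars ℚ)
  W := X.W.map s
  V := X.V.map s
  finite := inferInstance
  isLog := hs.isQbarLogSubspace_map X.isLog
  isRat := hs.isQbarRational_map X.isRat
  hYV := by
    rw [Submodule.map_le_iff_le_comap]
    intro y hy
    exact ⟨y, X.hYV hy, rfl⟩
  hWV := Submodule.map_mono X.hWV

/-- `s(X)` lives in `K^{d₀'} × K^{d₁'}`. [folklore] -/
@[simp] theorem mapObj_d₀ (X : Obj) (s : LinTangent X.d₀ X.d₁ →ₗ[ℂ] LinTangent d₀' d₁')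
    (hs : IsBiRational s) : (X.mapObj s hs).d₀ = d₀' := rfl

/-- `s(X)` lives in `K^{d₀'} × K^{d₁'}`. [folklore] -/
@[simp] theorem mapObj_d₁ (X : Obj) (s : LinTangent X.d₀ X.d₁ →ₗ[ℂ] LinTangent d₀' d₁')
    (hs : IsBiRational s) : (X.mapObj s hs).d₁ = d₁' := rfl

/-- `Y' = s(Y)`. [cite: Roy1992, §2 (p. 26)] -/
@[simp] theorem mapObj_Y (X : Obj) (s : LinTangent X.d₀ X.d₁ →ₗ[ℂ] LinTangent d₀' d₁')
    (hs : IsBiRational s) : (X.mapObj s hs).Y = X.Y.map (s.restrictScalars ℚ) := rfl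

/-- `W' = s(W)`. [cite: Roy1992, §2 (p. 26)] -/
@[simp] theorem mapObj_W (X : Obj) (s : LinTangent X.d₀ X.d₁ →ₗ[ℂ] LinTangent d₀' d₁')
    (hs : IsBiRational s) : (X.mapObj s hs).W = X.W.map s := rfl

/-- `V' = s(V)`. [cite: Roy1992, §2 (p. 26)] -/
@[simp] theorem mapObj_V (X : Obj) (s : LinTangent X.d₀ X.d₁ →ₗ[ℂ] LinTangent d₀' d₁')
    (hs : IsBiRational s) : (X.mapObj s hs).V = X.V.map s := rfl

/-- **Cokernels of `𝒞`**: "`(X, X', s)` is a cokernel of `𝒞` if the linear mapping `s` is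
surjective and satisfies `Y' = s(Y)`, `W' = s(W)`, `V' = s(V)`" (`s` a morphism).
[cite: Roy1992, §2 (p. 26)] -/
def IsCokerMap (X X' : Obj) (s : LinTangent X.d₀ X.d₁ →ₗ[ℂ] LinTangent X'.d₀ X'.d₁) : Prop :=
  IsAdmissible s ∧ X'.Y = X.Y.map (s.restrictScalars ℚ) ∧ X'.W = X.W.map s ∧ X'.V = X.V.map s

/-- **Kernels of `𝒞`**: "`(X*, X, i)` is a kernel of `𝒞` if the linear mapping `i` is injective and
satisfies `Y* = i⁻¹(Y)`, `W* = i⁻¹(W)`, `V* = i⁻¹(V)`" (`i` a morphism). [cite: Roy1992, §2 (p. 26)] -/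
def IsKerMap (A X : Obj) (i : LinTangent A.d₀ A.d₁ →ₗ[ℂ] LinTangent X.d₀ X.d₁) : Prop :=
  Function.Injective i ∧ IsBiRational i ∧ A.Y = X.Y.comap (i.restrictScalars ℚ) ∧
    A.W = X.W.comap i ∧ A.V = X.V.comap i

/-- `(X, s(X), s)` is a cokernel for every admissible `s`. [cite: Roy1992, §2 proof of Proposition 3 (p. 29)] -/
theorem isCokerMap_mapObj (X : Obj) {s : LinTangent X.d₀ X.d₁ →ₗ[ℂ] LinTangent d₀' d₁'}
    (hs : IsAdmissible s) : X.IsCokerMap (X.mapObj s hs.2) s :=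
  ⟨hs, rfl, rfl, rfl⟩

/-- The identity is a cokernel `X → X`. [folklore] -/
theorem isCokerMap_id (X : Obj) : X.IsCokerMap X LinearMap.id :=
  ⟨isAdmissible_id _ _, by simp [LinearMap.restrictScalars_id], by simp, by simp⟩

/-- The identity is a kernel `X → X`. [folklore] -/
theorem isKerMap_id (X : Obj) : X.IsKerMap X LinearMap.id :=
  ⟨Function.injective_id, IsBiRational.id _ _, by simp [LinearMap.restrictScalars_id], by simp,
    by simp⟩

/-- Cokernels compose. [cite: Roy1992, §2 Proposition 1 (p. 27)] -/
theorem IsCokerMap.comp {X X' X'' : Obj} {s : LinTangent X.d₀ X.d₁ →ₗ[ℂ] LinTangent X'.d₀ X'.d₁}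
    {s' : LinTangent X'.d₀ X'.d₁ →ₗ[ℂ] LinTangent X''.d₀ X''.d₁} (hs : X.IsCokerMap X' s)
    (hs' : X'.IsCokerMap X'' s') : X.IsCokerMap X'' (s' ∘ₗ s) := by
  obtain ⟨h1, h2, h3, h4⟩ := hs
  obtain ⟨h1', h2', h3', h4'⟩ := hs'
  refine ⟨isAdmissible_comp h1' h1, ?_, ?_, ?_⟩
  · rw [h2', h2, LinearMap.restrictScalars_comp, Submodule.map_comp]
  · rw [h3', h3, Submodule.map_comp]
  · rw [h4', h4, Submodule.map_comp]

/-- Kernels compose. [cite: Roy1992, §2 Proposition 1 (p. 27)] -/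
theorem IsKerMap.comp {A' A X : Obj} {i' : LinTangent A'.d₀ A'.d₁ →ₗ[ℂ] LinTangent A.d₀ A.d₁}
    {i : LinTangent A.d₀ A.d₁ →ₗ[ℂ] LinTangent X.d₀ X.d₁} (hi' : A'.IsKerMap A i')
    (hi : A.IsKerMap X i) : A'.IsKerMap X (i ∘ₗ i') := by
  obtain ⟨h1, h2, h3, h4, h5⟩ := hi
  obtain ⟨h1', h2', h3', h4', h5'⟩ := hi'
  refine ⟨h1.comp h1', h2.comp h2', ?_, ?_, ?_⟩
  · rw [h3', h3, LinearMap.restrictScalars_comp, Submodule.comap_comp]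
  · rw [h4', h4, Submodule.comap_comp]
  · rw [h5', h5, Submodule.comap_comp]

end Obj

/-! ### The functions `a, b, c, d, r, d₀, d₁` -/

/-- `a(X) = d₁ − dim_ℚ(Y ∩ Ω)`, `Ω = 0 × ωℚ^{d₁}`. [cite: Roy1992, §2 (p. 27)] -/
def fa (X : Obj) : ℕ := X.d₁ - finrank ℚ ↥(X.Y ⊓ Omega X.d₀ X.d₁)

/-- `b(X) = d₀ + d₁ − dim_K(V)`. [cite: Roy1992, §2 (p. 27)] -/
def fb (X : Obj) : ℕ := X.d₀ + X.d₁ - finrank ℂ X.V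

/-- `c(X) = dim_ℚ(Y)`. [cite: Roy1992, §2 (p. 27)] -/
def fc (X : Obj) : ℕ := finrank ℚ X.Y

/-- `d(X) = dim_K(V/W)` (`= dim_K V − dim_K W`, `W ⊆ V`). [cite: Roy1992, §2 (p. 27)] -/
def fd (X : Obj) : ℕ := finrank ℂ X.V - finrank ℂ X.W

/-- `r(X) = d₀ + d₁`. [cite: Roy1992, §2 (p. 27)] -/
def fr (X : Obj) : ℕ := X.d₀ + X.d₁

/-- `d₀(X) = d₀`. [cite: Roy1992, §2 (p. 27)] -/
def fd₀ (X : Obj) : ℕ := X.d₀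

/-- `d₁(X) = d₁`. [cite: Roy1992, §2 (p. 27)] -/
def fd₁ (X : Obj) : ℕ := X.d₁

/-- `dim_K (K^{d₀} × K^{d₁}) = d₀ + d₁`. [folklore] -/
theorem finrank_linTangent (d₀ d₁ : ℕ) : finrank ℂ (LinTangent d₀ d₁) = d₀ + d₁ := by
  rw [Module.finrank_prod, Module.finrank_fin_fun, Module.finrank_fin_fun]

/-- `Ω` is finite dimensional over `ℚ`. [folklore] -/
instance (d₀ d₁ : ℕ) : FiniteDimensional ℚ (Omega d₀ d₁) :=
  FiniteDimensional.span_of_finite ℚ (Set.finite_range _)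

/-- `dim_ℚ Ω ≤ d₁`. [folklore] -/
theorem finrank_omega_le (d₀ d₁ : ℕ) : finrank ℚ (Omega d₀ d₁) ≤ d₁ := by
  unfold Omega
  exact (finrank_range_le_card _).trans (by simp)

namespace Obj

variable (X : Obj)

/-- `dim_K V ≤ d₀ + d₁`. [folklore] -/
theorem finrank_V_le : finrank ℂ X.V ≤ X.d₀ + X.d₁ := by
  rw [← finrank_linTangent]
  exact Submodule.finrank_le _

/-- `dim_K W ≤ dim_K V`. [folklore] -/
theorem finrank_W_le : finrank ℂ X.W ≤ finrank ℂ X.V :=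
  Submodule.finrank_mono X.hWV

/-- `dim_ℚ(Y ∩ Ω) ≤ d₁`. [folklore] -/
theorem finrank_Y_inf_omega_le : finrank ℚ ↥(X.Y ⊓ Omega X.d₀ X.d₁) ≤ X.d₁ := by
  refine le_trans ?_ (finrank_omega_le X.d₀ X.d₁)
  exact LinearMap.finrank_le_finrank_of_injective
    (Submodule.inclusion_injective (inf_le_right : X.Y ⊓ Omega X.d₀ X.d₁ ≤ _))

/-- `a(X)` in `ℝ`. [folklore] -/
theorem cast_fa : ((fa X : ℕ) : ℝ) = (X.d₁ : ℝ) - finrank ℚ ↥(X.Y ⊓ Omega X.d₀ X.d₁) := by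
  unfold fa
  rw [Nat.cast_sub X.finrank_Y_inf_omega_le]

/-- `b(X)` in `ℝ`. [folklore] -/
theorem cast_fb : ((fb X : ℕ) : ℝ) = (X.d₀ : ℝ) + X.d₁ - finrank ℂ X.V := by
  unfold fb
  rw [Nat.cast_sub X.finrank_V_le, Nat.cast_add]

/-- `b(X) + d(X) = d₀ + d₁ − dim_K W` in `ℝ`. [folklore] -/
theorem cast_fb_add_fd : ((fb X : ℕ) : ℝ) + fd X = (X.d₀ : ℝ) + X.d₁ - finrank ℂ X.W := by
  unfold fd
  rw [cast_fb, Nat.cast_sub X.finrank_W_le]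
  ring

/-- `a(X) ≤ d₁(X)` (first assertion of Proposition 3). [cite: Roy1992, §2 Proposition 3 (p. 28)] -/
theorem fa_le_fd₁ : fa X ≤ fd₁ X := Nat.sub_le _ _

/-- `b(X) ≠ 0 ↔ V ≠ K^{d₀} × K^{d₁}`. [folklore] -/
theorem fb_ne_zero_iff : fb X ≠ 0 ↔ X.V ≠ ⊤ := by
  unfold fb
  constructor
  · intro h hV
    apply h
    rw [hV, finrank_top, finrank_linTangent, Nat.sub_self]
  · intro hV h
    apply hV
    apply Submodule.eq_top_of_finrank_eq
    rw [finrank_linTangent]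
    have := X.finrank_V_le
    omega

/-- `b(X') + d(X') ≠ 0 ↔ W' ≠ K^{d₀'} × K^{d₁'}`. [folklore] -/
theorem fb_add_fd_ne_zero_iff : fb X + fd X ≠ 0 ↔ X.W ≠ ⊤ := by
  unfold fb fd
  have h1 := X.finrank_V_le
  have h2 := X.finrank_W_le
  constructor
  · intro h hW
    apply h
    have : finrank ℂ X.W = X.d₀ + X.d₁ := by rw [hW, finrank_top, finrank_linTangent]
    omega
  · intro hW h
    apply hW
    apply Submodule.eq_top_of_finrank_eq
    rw [finrank_linTangent]
    omega

/-- **The ratio of Theorem 2 is `d₁(X')/b(X')`**: for a cokernel `(X, X', s)`,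
`d₁'/(d₀' + d₁' − dim_K(s(V))) = d₁(X')/b(X')`. [cite: Roy1992, §2 Theorem 2bis (p. 27)] -/
theorem thm2Ratio_eq {X X' : Obj} {s : LinTangent X.d₀ X.d₁ →ₗ[ℂ] LinTangent X'.d₀ X'.d₁}
    (hs : X.IsCokerMap X' s) : thm2Ratio X.V X'.d₀ X'.d₁ s = (fd₁ X' : ℝ) / fb X' := by
  rw [cast_fb, thm2Ratio, ← hs.2.2.2]
  rfl

/-! ### Bad kernels versus `s(V) ∩ (ℚ̄^{d₀'} × 0) = 0` -/

/-- Every `K`-subspace of `K¹ × K⁰` is rational over `ℚ̄` (it is `0` or spanned by `(1, 0)`). [folklore] -/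
theorem isQbarRational_of_one_zero (T : Submodule ℂ (LinTangent 1 0)) : IsQbarRational T := by
  unfold IsQbarRational
  refine le_antisymm (fun u hu => ?_) (Submodule.span_le.2 fun v hv => hv.1)
  by_cases hu0 : u.1 0 = 0
  · have : u = 0 := by
      ext i
      · rw [Subsingleton.elim i 0, hu0]; rfl
      · exact Fin.elim0 i
    rw [this]
    exact Submodule.zero_mem _
  · -- `e = (u.1 0)⁻¹ • u = (1, 0)` is a `ℚ̄`-point of `T` and `u = (u.1 0) • e`
    set e : LinTangent 1 0 := (u.1 0)⁻¹ • u with he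
    have heT : e ∈ T := Submodule.smul_mem _ _ hu
    have heq : IsQbarPoint e := by
      refine ⟨fun i => ?_, fun j => Fin.elim0 j⟩
      rw [Subsingleton.elim i 0, he, Prod.smul_fst, Pi.smul_apply, smul_eq_mul,
        inv_mul_cancel₀ hu0]
      exact one_mem _
    have hu : u = (u.1 0) • e := by
      rw [he, smul_smul, mul_inv_cancel₀ hu0, one_smul]
    rw [hu]
    exact Submodule.smul_mem _ _ (Submodule.subset_span ⟨heT, heq⟩)

/-- **"No kernel `i : X* → X'` with `d₁(X*) = b(X*) = 0` and `r(X*) ≠ 0`" is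
"`V' ∩ (ℚ̄^{d₀'} × 0) = 0`"** (the translation between Theorem 2bis and Theorem 2): such a kernel
has `V* = K^{d₀*} × K^{d₁*}` with `d₀* > 0` and sends `(e₁, 0)` to a non-zero point of
`V' ∩ (ℚ̄^{d₀'} × 0)`; conversely a non-zero `v ∈ V' ∩ (ℚ̄^{d₀'} × 0)` gives the kernel
`K¹ × K⁰ → K^{d₀'} × K^{d₁'}`, `t ↦ t v`, with `d₁(X*) = 0`, `b(X*) = 0`, `r(X*) = 1`.
[cite: Roy1992, §1 Theorem 2 (p. 25) and §2 Theorem 2bis (p. 27)] -/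
theorem noBadKernel_iff (X' : Obj) :
    (¬ ∃ (A : Obj) (i : LinTangent A.d₀ A.d₁ →ₗ[ℂ] LinTangent X'.d₀ X'.d₁),
        A.IsKerMap X' i ∧ fd₁ A = 0 ∧ fb A = 0 ∧ fr A ≠ 0) ↔
      ∀ v ∈ X'.V, (∀ k, v.1 k ∈ algebraicClosure ℚ ℂ) → v.2 = 0 → v = 0 := by
  constructor
  · intro hno v hvV hv1 hv2
    by_contra hv0
    apply hno
    -- the kernel `K¹ × K⁰ → K^{d₀'} × K^{d₁'}`, `(t, u) ↦ t 0 • v`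
    let i : LinTangent 1 0 →ₗ[ℂ] LinTangent X'.d₀ X'.d₁ :=
      (LinearMap.proj (0 : Fin 1) ∘ₗ LinearMap.fst ℂ (Fin 1 → ℂ) (Fin 0 → ℂ)).smulRight v
    have hi : ∀ p : LinTangent 1 0, i p = p.1 0 • v := fun p => rfl
    have hinj : Function.Injective i := by
      rw [injective_iff_map_eq_zero]
      intro p hp
      rw [hi, smul_eq_zero] at hp
      rcases hp with hp | hp
      · ext k
        · rw [Subsingleton.elim k 0, hp]; rfl
        · exact Fin.elim0 k
      · exact absurd hp hv0
    have hbi : IsBiRational i := by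
      refine ⟨fun x hx => ⟨fun k => ?_, ?_⟩, fun y _ => ⟨?_, fun j => ⟨0, ?_⟩⟩⟩
      · rw [hi, Prod.smul_fst, Pi.smul_apply, smul_eq_mul]
        exact mul_mem (hx 0) (hv1 k)
      · rw [hi, Prod.smul_snd, hv2, smul_zero]
      · rw [hi]; simp
      · rw [hi]; simp
    -- some coordinate of `v.1` is a non-zero algebraic number
    obtain ⟨k₀, hk₀⟩ : ∃ k, v.1 k ≠ 0 := by
      by_contra hall
      simp only [not_exists, not_not] at hall
      exact hv0 (Prod.ext (funext hall) hv2)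
    haveI := X'.finite
    let A : Obj :=
      { d₀ := 1
        d₁ := 0
        Y := X'.Y.comap (i.restrictScalars ℚ)
        W := X'.W.comap i
        V := X'.V.comap i
        finite := by
          refine Module.Finite.of_injective
            ((i.restrictScalars ℚ).restrict (p := X'.Y.comap (i.restrictScalars ℚ)) (q := X'.Y)
              fun x hx => hx) ?_
          intro x y hxy
          apply Subtype.ext
          apply hinj
          have := congrArg Subtype.val hxy
          simpa using this
        isLog := by
          intro y hy
          refine ⟨fun k => ?_, fun j => Fin.elim0 j⟩
          rw [Subsingleton.elim k 0]
          have hmem : (i y).1 k₀ ∈ algebraicClosure ℚ ℂ := (X'.isLog _ hy).1 k₀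
          rw [hi, Prod.smul_fst, Pi.smul_apply, smul_eq_mul] at hmem
          have : y.1 0 = y.1 0 * v.1 k₀ * (v.1 k₀)⁻¹ := by
            rw [mul_assoc, mul_inv_cancel₀ hk₀, mul_one]
          rw [this]
          exact mul_mem hmem (inv_mem (hv1 k₀))
        isRat := isQbarRational_of_one_zero _
        hYV := fun y hy => X'.hYV hy
        hWV := Submodule.comap_mono X'.hWV }
    have hAV : A.V = ⊤ := by
      rw [eq_top_iff]
      intro p _
      show i p ∈ X'.V
      rw [hi]
      exact Submodule.smul_mem _ _ hvV
    refine ⟨A, i, ⟨hinj, hbi, rfl, rfl, rfl⟩, rfl, ?_, ?_⟩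
    · show 1 + 0 - finrank ℂ A.V = 0
      rw [hAV, finrank_top, finrank_linTangent]
      rfl
    · show (1 : ℕ) + 0 ≠ 0
      norm_num
  · rintro h ⟨A, i, ⟨hinj, hbi, -, -, hAV⟩, hd₁, hb, hr⟩
    have hd₀ : 0 < A.d₀ := by
      change A.d₁ = 0 at hd₁
      unfold fr at hr
      omega
    -- `V* = K^{d₀*} × K^{d₁*}`
    have hVtop : A.V = ⊤ := by
      apply Submodule.eq_top_of_finrank_eq
      rw [finrank_linTangent]
      have := A.finrank_V_le
      unfold fb at hb
      omega
    -- `(e₁, 0) ↦` a non-zero point of `V' ∩ (ℚ̄^{d₀'} × 0)`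
    set e : LinTangent A.d₀ A.d₁ := (Pi.single ⟨0, hd₀⟩ 1, 0) with he
    have healg : ∀ k, (Pi.single (⟨0, hd₀⟩ : Fin A.d₀) (1 : ℂ) : Fin A.d₀ → ℂ) k ∈
        algebraicClosure ℚ ℂ := by
      intro k
      by_cases hk : k = ⟨0, hd₀⟩
      · subst hk; simp
      · simp [hk]
    obtain ⟨h1, h2⟩ := hbi.1 _ healg
    have heV : i e ∈ X'.V := by
      have : e ∈ A.V := by rw [hVtop]; trivial
      rwa [hAV] at this
    have hie : i e = 0 := h _ heV h1 h2
    have he0 : e = 0 := hinj (by rw [hie, map_zero])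
    have := congrArg (fun p : LinTangent A.d₀ A.d₁ => p.1 ⟨0, hd₀⟩) he0
    simp [he] at this

/-! ### Theorem 1bis and the minimality condition of Theorem 2, object by object -/

/-- For a cokernel `(X, X', s)`: `b(X') ≠ 0 ↔ s(V) ≠ K^{d₀'} × K^{d₁'}`. [folklore] -/
theorem IsCokerMap.fb_ne_zero_iff {X X' : Obj} {s : LinTangent X.d₀ X.d₁ →ₗ[ℂ] LinTangent X'.d₀ X'.d₁}
    (hs : X.IsCokerMap X' s) : fb X' ≠ 0 ↔ X.V.map s ≠ ⊤ := by
  rw [Obj.fb_ne_zero_iff, hs.2.2.2]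

/-- **Theorem 1bis from Theorem 1**, object by object: if `b(X) ≠ 0` (i.e. `V ≠ K^{d₀} × K^{d₁}`),
Theorem 1 gives an admissible `s` with, for `X' = s(X)`, `b(X') + d(X') ≠ 0` and
`(a(X') + c(X'))/(b(X') + d(X')) ≤ a(X)/b(X)`. [cite: Roy1992, §2 Theorem 1bis (p. 27)] -/
theorem exists_mapObj_of_thm1 (h : roy1992_thm1) (X : Obj) (hb : fb X ≠ 0) :
    ∃ (d₀' d₁' : ℕ) (s : LinTangent X.d₀ X.d₁ →ₗ[ℂ] LinTangent d₀' d₁') (hs : IsAdmissible s),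
      fb (X.mapObj s hs.2) + fd (X.mapObj s hs.2) ≠ 0 ∧
        ((fa (X.mapObj s hs.2) : ℝ) + fc (X.mapObj s hs.2)) /
            ((fb (X.mapObj s hs.2) : ℝ) + fd (X.mapObj s hs.2)) ≤ (fa X : ℝ) / fb X := by
  obtain ⟨d₀', d₁', s, hs, hW, hineq⟩ :=
    h X.d₀ X.d₁ X.Y X.W X.V X.finite X.isLog X.isRat X.hYV X.hWV ((fb_ne_zero_iff X).1 hb)
  refine ⟨d₀', d₁', s, hs, ?_, ?_⟩
  · rw [fb_add_fd_ne_zero_iff]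
    exact hW
  · rw [cast_fb_add_fd, cast_fa, cast_fa, cast_fb]
    exact hineq

/-- **The minimality of Theorem 2 is the minimality of Theorem 2bis**: for a cokernel `(X, X', s)`,
`s` minimises `d₁'/(d₀' + d₁' − dim_K(s(V)))` among the admissible maps with `s(V) ≠ K^{d₀'} × K^{d₁'}`
(`IsThm2Minimal`) iff `b(X') ≠ 0` and `d₁(X')/b(X') ≤ d₁(X'')/b(X'')` for every cokernel
`(X, X'', s'')` with `b(X'') ≠ 0`. [cite: Roy1992, §1 Theorem 2 (p. 25) and §2 Theorem 2bis (p. 27)] -/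
theorem IsCokerMap.isThm2Minimal_iff {X X' : Obj}
    {s : LinTangent X.d₀ X.d₁ →ₗ[ℂ] LinTangent X'.d₀ X'.d₁} (hs : X.IsCokerMap X' s) :
    IsThm2Minimal X.V X'.d₀ X'.d₁ s ↔
      fb X' ≠ 0 ∧ ∀ (X'' : Obj) (s'' : LinTangent X.d₀ X.d₁ →ₗ[ℂ] LinTangent X''.d₀ X''.d₁),
        X.IsCokerMap X'' s'' → fb X'' ≠ 0 → (fd₁ X' : ℝ) / fb X' ≤ (fd₁ X'' : ℝ) / fb X'' := by
  constructor
  · rintro ⟨-, htop, hmin⟩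
    refine ⟨hs.fb_ne_zero_iff.2 htop, fun X'' s'' hs'' hb'' => ?_⟩
    rw [← thm2Ratio_eq hs, ← thm2Ratio_eq hs'']
    exact hmin X''.d₀ X''.d₁ s'' hs''.1 (hs''.fb_ne_zero_iff.1 hb'')
  · rintro ⟨hb', hmin⟩
    refine ⟨hs.1, hs.fb_ne_zero_iff.1 hb', fun d₀'' d₁'' s'' hs'' htop'' => ?_⟩
    have hc := X.isCokerMap_mapObj hs''
    have h := hmin _ s'' hc (hc.fb_ne_zero_iff.2 htop'')
    rwa [← thm2Ratio_eq hs, ← thm2Ratio_eq hc] at h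

end Obj

end Literature.Barriers.Schanuel.Roy1992
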